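import Summits.AnomalousDissipation.AnomalousDissipation.Theorems.StirringSphereEnsembleRealizationStubAugCurrentDivergence

/-!
# Crux `EnsembleRealization` (stmt-AnomalousDissipation-0215) — line `augmented-lift`,
# sub-stub M1 `stub_augCurrent`, piece (M1a)/L4: the stationary pair `(m, V)` of a current

Supports stmt-AnomalousDissipation-0215 (stub `stub_augCurrent` of line `augmented-lift`, piece
M1a `stub_augCurrentLevelPairs`, step (A4) of `augCurrent-notes.md` §3). Nothing here closes an
item. Theorems only.

Given, on `ℝ^D × ℝ` with the Haar measure `vol = volume ⊗ volume`: a compact box `Bx` of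
positive volume, a `C¹` current `J` with `tsupport J ⊆ Bx` and vanishing classical divergence,
a `C¹` density `p₁ ≥ 0` vanishing off `Bx` with `∫ p₁ = 1` (the mollified coordinate law), and
`0 < ε < 1`: the PAIR `m = (1 − ε) p₁ · vol + ε c · vol|_{Bx}` (`c = 1 / vol(Bx)`; a probability
measure carried by `Bx`) and `V = (1 − ε) J / ((1 − ε) p₁ + ε c)` (`C¹`, compact support in
`Bx`) satisfies the weak stationary Liouville equation `∫ Dψ[V] dm = 0`
(`stub_augCurrentDivergenceTools`), with the transport formula
`∫ G dm = (1 − ε) ∫ G p₁ dvol + ε c ∫_{Bx} G dvol` for continuous `G`. Packaged as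
`stub_augCurrentPairTools`.
-/

noncomputable section

set_option linter.dupNamespace false

open MeasureTheory Set Filter Topology Function Metric
open scoped BigOperators ENNReal NNReal

namespace Summit.AnomalousDissipation.AnomalousDissipation.Theorems.EnsembleRealization

/-- **Pair tools for (M1a).** See the module docstring. -/
theorem stub_augCurrentPairTools {D : ℕ} {Bx : Set (EuclideanSpace ℝ (Fin D) × ℝ)} (hBx : IsCompact Bx)
    (hBx0 : ((volume : Measure (EuclideanSpace ℝ (Fin D))).prod (volume : Measure ℝ)) Bx ≠ 0)
    {J : EuclideanSpace ℝ (Fin D) × ℝ → EuclideanSpace ℝ (Fin D) × ℝ} (hJ : ContDiff ℝ 1 J)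
    (hJB : tsupport J ⊆ Bx)
    (hdiv : ∀ z, ∑ j, fderiv ℝ (fun z => (J z).1 j) z (EuclideanSpace.single j 1, 0) +
      fderiv ℝ (fun z => (J z).2) z (0, 1) = 0)
    {p₁ : EuclideanSpace ℝ (Fin D) × ℝ → ℝ} (hp : ContDiff ℝ 1 p₁) (hp0 : ∀ z, 0 ≤ p₁ z)
    (hpB : ∀ z, z ∉ Bx → p₁ z = 0)
    (hp1 : ∫ z, p₁ z ∂((volume : Measure (EuclideanSpace ℝ (Fin D))).prod (volume : Measure ℝ)) = 1)
    {ε : ℝ} (hε : 0 < ε) (hε1 : ε < 1) :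
    ∃ (c : ℝ) (m : Measure (EuclideanSpace ℝ (Fin D) × ℝ))
      (V : EuclideanSpace ℝ (Fin D) × ℝ → EuclideanSpace ℝ (Fin D) × ℝ),
      0 < c ∧ (∀ z, 0 < (1 - ε) * p₁ z + ε * c) ∧
      (∀ z, V z = ((1 - ε) / ((1 - ε) * p₁ z + ε * c)) • J z) ∧
      IsProbabilityMeasure m ∧ m Bxᶜ = 0 ∧ ContDiff ℝ 1 V ∧ HasCompactSupport V ∧ tsupport V ⊆ Bx ∧
      (∀ ψ : EuclideanSpace ℝ (Fin D) × ℝ → ℝ, ContDiff ℝ 1 ψ → HasCompactSupport ψ →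
        ∫ z, fderiv ℝ ψ z (V z) ∂m = 0) ∧
      (∀ G : EuclideanSpace ℝ (Fin D) × ℝ → ℝ, Continuous G →
        ∫ z, G z ∂m = (1 - ε) * ∫ z, G z * p₁ z ∂((volume : Measure (EuclideanSpace ℝ (Fin D))).prod (volume : Measure ℝ)) +
          ε * c * ∫ z in Bx, G z ∂((volume : Measure (EuclideanSpace ℝ (Fin D))).prod (volume : Measure ℝ))) := by
  set vol : Measure (EuclideanSpace ℝ (Fin D) × ℝ) :=
    (volume : Measure (EuclideanSpace ℝ (Fin D))).prod (volume : Measure ℝ) with hvol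
  have hBxfin : vol Bx < ∞ := hBx.measure_lt_top
  set c : ℝ := (vol Bx).toReal⁻¹ with hc
  have hvpos : 0 < (vol Bx).toReal := ENNReal.toReal_pos hBx0 hBxfin.ne
  have hcpos : 0 < c := inv_pos.2 hvpos
  have hcvol : c * (vol Bx).toReal = 1 := inv_mul_cancel₀ hvpos.ne'
  have h1ε : 0 < 1 - ε := by linarith
  -- the positive denominator
  set q : EuclideanSpace ℝ (Fin D) × ℝ → ℝ := fun z => (1 - ε) * p₁ z + ε * c with hq
  have hqpos : ∀ z, 0 < q z := fun z => by
    have := mul_nonneg h1ε.le (hp0 z); have := mul_pos hε hcpos; simp only [hq]; linarith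
  have hqc : ContDiff ℝ 1 q := (contDiff_const.mul hp).add contDiff_const
  -- the field
  set V : EuclideanSpace ℝ (Fin D) × ℝ → EuclideanSpace ℝ (Fin D) × ℝ := fun z => ((1 - ε) / q z) • J z with hV
  have hVc1 : ContDiff ℝ 1 V := (contDiff_const.div hqc fun z => (hqpos z).ne').smul hJ
  have hVB : tsupport V ⊆ Bx := (tsupport_smul_subset_right (fun z => (1 - ε) / q z) J).trans hJB
  have hVcs : HasCompactSupport V := hBx.of_isClosed_subset (isClosed_tsupport _) hVB
  have hJ0 : ∀ z, z ∉ Bx → J z = 0 := fun z hz => image_eq_zero_of_notMem_tsupport fun h => hz (hJB h)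
  have hV0 : ∀ z, z ∉ Bx → V z = 0 := fun z hz => image_eq_zero_of_notMem_tsupport fun h => hz (hVB h)
  have hqV : ∀ z, q z • V z = (1 - ε) • J z := fun z => by
    simp only [hV, smul_smul]
    rw [mul_div_cancel₀ _ (hqpos z).ne']
  -- the measure (density written through `Real.toNNReal`, so that `ENNReal.ofReal = ↑toNNReal`)
  set d : EuclideanSpace ℝ (Fin D) × ℝ → ℝ≥0 := fun z => ((1 - ε) * p₁ z).toNNReal with hd
  have hdm : Measurable d := measurable_real_toNNReal.comp (measurable_const.mul hp.continuous.measurable)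
  have hdcoe : ∀ z, (d z : ℝ) = (1 - ε) * p₁ z := fun z => Real.coe_toNNReal _ (mul_nonneg h1ε.le (hp0 z))
  set m : Measure (EuclideanSpace ℝ (Fin D) × ℝ) :=
    vol.withDensity (fun z => (d z : ℝ≥0∞)) + ENNReal.ofReal (ε * c) • vol.restrict Bx with hm
  have hpcs : HasCompactSupport p₁ := HasCompactSupport.intro hBx hpB
  have hp1i : Integrable p₁ vol := hp.continuous.integrable_of_hasCompactSupport hpcs
  haveI : vol.IsAddHaarMeasure := by rw [hvol]; infer_instance
  -- transport formula
  have htrans : ∀ G : EuclideanSpace ℝ (Fin D) × ℝ → ℝ, Continuous G →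
      ∫ z, G z ∂m = (1 - ε) * ∫ z, G z * p₁ z ∂vol + ε * c * ∫ z in Bx, G z ∂vol := by
    intro G hG
    have hsmul : ∀ z, d z • G z = (1 - ε) * (G z * p₁ z) := fun z => by
      rw [NNReal.smul_def, smul_eq_mul, hdcoe]; ring
    have hGd : Integrable (fun z => d z • G z) vol := by
      simp_rw [hsmul]
      exact ((hG.mul hp.continuous).integrable_of_hasCompactSupport hpcs.mul_left).const_mul _
    have hGi1 : Integrable G (vol.withDensity fun z => (d z : ℝ≥0∞)) :=
      (integrable_withDensity_iff_integrable_smul hdm).2 hGd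
    have hGi2 : Integrable G (ENNReal.ofReal (ε * c) • vol.restrict Bx) :=
      (hG.continuousOn.integrableOn_compact hBx).integrable.smul_measure ENNReal.ofReal_ne_top
    rw [hm, integral_add_measure hGi1 hGi2, integral_withDensity_eq_integral_smul hdm,
      integral_smul_measure, ENNReal.toReal_ofReal (mul_nonneg hε.le hcpos.le)]
    simp_rw [hsmul]
    rw [integral_const_mul, smul_eq_mul]
  -- probability
  have hprob : IsProbabilityMeasure m := by
    refine ⟨?_⟩
    rw [hm, Measure.add_apply, withDensity_apply _ MeasurableSet.univ, Measure.restrict_univ,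
      Measure.smul_apply, Measure.restrict_apply MeasurableSet.univ, univ_inter, smul_eq_mul]
    have h1 : ∫⁻ z, (d z : ℝ≥0∞) ∂vol = ENNReal.ofReal (1 - ε) := by
      have h2 : (fun z => (d z : ℝ≥0∞)) = fun z => ENNReal.ofReal ((1 - ε) * p₁ z) := rfl
      rw [h2, ← ofReal_integral_eq_lintegral_ofReal (hp1i.const_mul _)
        (Eventually.of_forall fun z => mul_nonneg h1ε.le (hp0 z)), integral_const_mul, hp1, mul_one]
    have h3 : ENNReal.ofReal (ε * c) * vol Bx = ENNReal.ofReal ε := by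
      rw [← ENNReal.ofReal_toReal hBxfin.ne, ← ENNReal.ofReal_mul (mul_nonneg hε.le hcpos.le),
        mul_assoc, hcvol, mul_one]
    rw [h1, h3, ← ENNReal.ofReal_add (by linarith) hε.le]
    simp
  -- carried by the box
  have hmB : m Bxᶜ = 0 := by
    have hmeas : MeasurableSet Bxᶜ := hBx.isClosed.measurableSet.compl
    rw [hm, Measure.add_apply, withDensity_apply _ hmeas, Measure.smul_apply,
      Measure.restrict_apply hmeas, compl_inter_self, measure_empty, smul_zero, add_zero]
    rw [setLIntegral_congr_fun hmeas (g := fun _ => 0) fun z hz => by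
      simp [d, hpB z hz], lintegral_zero]
  -- Liouville
  have hJcs : HasCompactSupport J := hBx.of_isClosed_subset (isClosed_tsupport _) hJB
  have hliou : ∀ ψ : EuclideanSpace ℝ (Fin D) × ℝ → ℝ, ContDiff ℝ 1 ψ → HasCompactSupport ψ →
      ∫ z, fderiv ℝ ψ z (V z) ∂m = 0 := by
    intro ψ hψ _
    have hGc : Continuous fun z => fderiv ℝ ψ z (V z) :=
      (hψ.continuous_fderiv one_ne_zero).clm_apply hVc1.continuous
    have hG0 : ∀ z, z ∉ Bx → fderiv ℝ ψ z (V z) = 0 := fun z hz => by rw [hV0 z hz, map_zero]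
    have hGcs : HasCompactSupport fun z => fderiv ℝ ψ z (V z) := HasCompactSupport.intro hBx hG0
    rw [htrans _ hGc, setIntegral_eq_integral_of_forall_compl_eq_zero hG0, ← integral_const_mul,
      ← integral_const_mul, ← integral_add]
    · have hpt : ∀ z, (1 - ε) * (fderiv ℝ ψ z (V z) * p₁ z) + ε * c * fderiv ℝ ψ z (V z) =
          (1 - ε) * fderiv ℝ ψ z (J z) := fun z => by
        have h := congrArg (fderiv ℝ ψ z) (hqV z)
        simp only [map_smul, smul_eq_mul, hq] at h
        linear_combination h
      simp_rw [hpt]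
      rw [integral_const_mul, stub_augCurrentDivergenceTools vol hJ hJcs hdiv hψ, mul_zero]
    · exact ((hGc.mul hp.continuous).integrable_of_hasCompactSupport hpcs.mul_left).const_mul _
    · exact (hGc.integrable_of_hasCompactSupport hGcs).const_mul _
  exact ⟨c, m, V, hcpos, hqpos, fun z => rfl, hprob, hmB, hVc1, hVcs, hVB, hliou, htrans⟩

end Summit.AnomalousDissipation.AnomalousDissipation.Theorems.EnsembleRealization
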